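import Summits.ResolutionOfSingularities.ResolutionOfSingularities.Theorems.FrobeniusClosingPatchingRelPerfectDepthLegalPieces
import Summits.ResolutionOfSingularities.ResolutionOfSingularities.Theorems.FrobeniusClosingPatchingRelPerfectDepthWeightTwoBCJS
import Summits.ResolutionOfSingularities.ResolutionOfSingularities.Theorems.FrobeniusClosingPatchingRelPerfectDepthWeightTwoBEnd
import Literature.AlgebraicGeometry.Resolution.EmbeddedResolutionExcellentSurfacesSequence
import Literature.AlgebraicGeometry.Resolution.RegularCentreComponents
import Literature.AlgebraicGeometry.Resolution.NormalCrossingsStrictification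
import Literature.AlgebraicGeometry.Resolution.MarkedIdealsEtale
import Mathlib.RingTheory.RegularLocalRing.Defs
import HarnessLib

/-!
# Crux `PatchingRelPerfect` (stmt-ResolutionOfSingularities-16161), chain W5.2 — T6-E1b residual
# `LegalScopedDivisorReduction₃`, PHASE 1 (hand #2): the LEGAL transport along an embedded resolution sequence
# with centres in the singular loci

[OURS · L1 W5.2 · `LegalScopedDivisorReduction₃` (res-L1-w52-idea-1 OWNER; plan-1 RULING R3 / STEER 5 (3)), hand #2
«phase-1 transport» (res-type-049), brick 2/2] Fact-free; NOT statements of the manuscript under review. NO named fact is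
consumed here: the Cossart–Jannsen–Saito-type sequence enters as DATA (`IsBPermissibleSequence`, the tree's per-step predicate
of CJS (6.2) WITH the clause «every point of the centre `D_j` is a singular point of the strict transform `X_j`» at EVERY
step), and the ∃-form `legalPhaseOne_of_truncated` takes a truncated sequence of that type as an INLINE HYPOTHESIS (the shape of
the chain's typing request F-32♯, res-lit-6 2026-08-27: Thm. 6.9 (a) + Cor. 6.26 (proof) + Def. 6.23 (2) + Lemma 2.31 of
LNM 2270 — every clause printed except «`D_i ⊂ Sing X_i` before the first regular stage», a two-line consequence) — never a
premise of the chain, to be re-keyed to the named fact when it is typed. NOT closable over F-32bR / F-60 (`IsBPermissibleSequenceB`: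
centres through boundary points at ORDER-ONE points of `H_j` are not legal — A₂ witness `V(xy − z³)`, RULING R3 (a)) nor over
F-32c (non-embedded, no n.c. bookkeeping; res-D-pv-016 2026-08-27 11:37:50Z (3)).

THE TRANSPORT (`cjs_pure_transport`, ISO-tolerant exactly as res-D-pv-054's T5-E `WeightTwoB.cjs_transport`): `E` integral
Noetherian regular, `H ≠ 0` locally principal with REDUCED zero scheme, `X = Supp H`. Along any `IsBPermissibleSequence X ∅ σ X' B'`
the state `WeightTwoB.StateIn H' D' ℬ' 𝒟'` — `H' = D' · monomialIdeal ℬ'`, the host `D'` an effective Cartier divisor EQUAL TO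
THE IDEAL OF ITS SUPPORT `= e⁻¹(cl X')` (the reduced strict transform), the boundary sheaves (supports `⊆ e⁻¹ B'`, irreducible,
none inside the host) with simple normal crossings, exponents = accumulated «order − 2» — is carried by a PURE WEIGHT-TWO
sequence `DepthTargets.IsPureWeightedSeq 2 ρ H H'` on `E' ≅ Z'` (empty-centre steps are isomorphisms, absorbed into `e`). Each
CJS centre is re-sequenced along its connected pieces (brick 1 `WeightTwoB.pure_pieces_loop`); EVERY PIECE IS LEGAL because its
points are singular points of the Cartier reduced host (`two_le_idealOrder_of_not_isRegularLocalRing_quotient`, the singularity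
read through the stalk isomorphisms of `e`).

THE END (`StateIn.isRegular_host`): the CJS-type end clause «the reduced strict transform `𝓘(cl X_m)` is regular» makes the
host `D'` a REGULAR hypersurface. The ∃-form `legalPhaseOne_of_truncated` packages transport + end: the output of PHASE 1 =
⟨`IsPureWeightedSeq 2 ρ H H'`, `StateIn H' D' ℬ' 𝒟'`, `D'.subscheme` regular⟩ — the input of the PEEL / PHASE 2 hands
(res-L1-w52-plan-1 RULING R3 (b)); `FlagState₃` follows along the sequence by res-type-003's `IsFlagSeq.flagState₃` once read
on the diagonal (res-D-pv-016's `IsFlagSeq.of_isPureWeightedSeq`).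

AI-written; AI review is weaker than expert review.

## References
* V. Cossart, U. Jannsen, S. Saito, LNM 2270 (2020), Thm. 1.4, Def. 3.1, Def. 4.1, (6.2), Def. 6.8, Thm. 6.9 (a), Cor. 6.26,
  Def. 6.23 (2), Lemma 2.31. [CossartJannsenSaito2020]
* E. Bierstone, D. Grigoriev, P. Milman, J. Włodarczyk, arXiv:1206.3090, Def. 3.1.3, Lemma 3.2.1 (1), §4 Step 2.
  [BierstoneGrigorievMilmanWlodarczyk2011]
* J. Kollár, *Lectures on Resolution of Singularities* (2007), 3.30.2, (3.111) Step 1. [Kollar2007]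
* H. Matsumura, *Commutative Ring Theory* (1986), Thm. 14.2. [Matsumura1987]
-/

-- `Summit.<Summit>.<Sub>.Theorems` with `Sub = Summit` (single-conjunct summit, D-0017)
set_option linter.dupNamespace false

noncomputable section

open CategoryTheory CategoryTheory.Limits AlgebraicGeometry TopologicalSpace IsLocalRing
open Literature.AlgebraicGeometry.Resolution Scheme.IdealSheafData

namespace Summit.ResolutionOfSingularities.ResolutionOfSingularities.Theorems

universe u

namespace WeightTwoB

open DepthSNC DepthTargets

/-! ## Singularity of the host read through the isomorphism `e : E' ≅ Z'` -/

/-- **Host order `≥ 2` at the points of a CJS centre**: if every point of `V(C) ⊆ Z'` is a singular point of the reduced strict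
transform `cl X'` (`𝒪_{Z',y} ⧸ 𝓘(cl X')_y` not regular) and the transport state on `E' ≅ Z'` has host support `e⁻¹(cl X')`, then the
host has order `≥ 2` at every point of `e^* C` (stalk isomorphisms of `e`; Matsumura 14.2 for the Cartier host).
[cite: Matsumura1987, Thm. 14.2] [cite: CossartJannsenSaito2020, (6.2)] -/
theorem StateIn.forall_two_le_of_sing {E' Z' : Scheme.{u}} [IsLocallyNoetherian E'] [IsLocallyNoetherian Z']
    {𝔟' D' : E'.IdealSheafData} {ℬ' 𝒟' : List (E'.IdealSheafData × ℕ)} (S : StateIn 𝔟' D' ℬ' 𝒟') (e : E' ≅ Z')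
    {X' : Set Z'} (hsupp : (D'.support : Set E') = e.hom ⁻¹' closure X') {C : Z'.IdealSheafData}
    (hsub : vanishingIdeal ⟨closure X', isClosed_closure⟩ ≤ C)
    (hsing : ∀ x ∈ (C.support : Set Z'), ¬ IsRegularLocalRing
      ((Z'.presheaf.stalk x) ⧸ stalkIdeal (vanishingIdeal ⟨closure X', isClosed_closure⟩) x)) :
    ∀ z ∈ ((C.comap e.hom).support : Set E'), (2 : ℕ∞) ≤ idealOrder D' z := by
  intro z hz
  have hC₀s : ((C.comap e.hom).support : Set E') = e.hom ⁻¹' C.support := by rw [support_comap]; rfl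
  have hzC : e.hom z ∈ (C.support : Set Z') := by rwa [hC₀s] at hz
  have hCX : (C.support : Set Z') ⊆ closure X' := by
    intro y hy
    have h : y ∈ ((vanishingIdeal (⟨closure X', isClosed_closure⟩ : Closeds Z')).support : Set Z') := support_antitone hsub hy
    rwa [Scheme.IdealSheafData.coe_support_vanishingIdeal] at h
  have hzD : z ∈ D'.support := by
    rw [← SetLike.mem_coe, hsupp]; exact hCX hzC
  haveI := S.regW z
  -- the host ideal is the pulled-back reduced ideal of `cl X'`
  have hDcomap : (vanishingIdeal (⟨closure X', isClosed_closure⟩ : Closeds Z')).comap e.hom = D' := by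
    rw [comap_hom_vanishingIdeal, S.hostRad]; congr 1; exact (Closeds.ext hsupp).symm
  refine two_le_idealOrder_of_not_isRegularLocalRing_quotient S.hostCartier hzD fun hreg' => hsing (e.hom z) hzC ?_
  -- transfer regularity of the quotient back through the stalk isomorphism of `e`
  let φ : Z'.presheaf.stalk (e.hom z) ≃+* E'.presheaf.stalk z := (asIso (e.hom.stalkMap z)).commRingCatIsoToRingEquiv
  have hφ : (φ : Z'.presheaf.stalk (e.hom z) →+* E'.presheaf.stalk z) = (e.hom.stalkMap z).hom := rfl
  have hI : stalkIdeal D' z =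
      (stalkIdeal (vanishingIdeal (⟨closure X', isClosed_closure⟩ : Closeds Z')) (e.hom z)).map
        (φ : Z'.presheaf.stalk (e.hom z) →+* E'.presheaf.stalk z) := by
    rw [hφ, ← stalkIdeal_comap_eq_map, hDcomap]
  haveI := hreg'
  exact IsRegularLocalRing.of_ringEquiv (Ideal.quotientEquiv _ _ φ hI).symm

/-! ## The transport along a sequence with centres in the singular loci -/

/-- **LEGAL (pure weight-two) transport along a CJS-type sequence whose centres lie in the singular loci of the strict
transforms** (see the module docstring): ISO-TOLERANT induction over `IsBPermissibleSequence`.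
[cite: CossartJannsenSaito2020, Thm. 1.4, (6.2), Def. 3.1, Def. 4.1] [cite: Kollar2007, (3.111) Step 1]
[cite: BierstoneGrigorievMilmanWlodarczyk2011, Lemma 3.2.1 (1)] -/
theorem cjs_pure_transport {E : Scheme.{u}} [IsIntegral E] [IsNoetherian E] (hE : Scheme.IsRegular E)
    (H : E.IdealSheafData) (hH : H ≠ ⊥) (hlp : IsLocallyPrincipal H) (hred : IsReduced H.subscheme) :
    ∀ {Z' : Scheme.{u}} {σ : Z' ⟶ E} {X' B' : Set Z'},
      IsBPermissibleSequence (H.support : Set E) (∅ : Set E) σ X' B' →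
      IsClosed X' ∧ ∃ (E' : Scheme.{u}) (_ : IsIntegral E') (_ : IsNoetherian E') (_ : IsNoetherian Z') (ρ : E' ⟶ E)
        (e : E' ≅ Z') (H' D' : E'.IdealSheafData) (ℬ' 𝒟' : List (E'.IdealSheafData × ℕ)),
        IsPureWeightedSeq 2 ρ H H' ∧ StateIn H' D' ℬ' 𝒟' ∧
        ((D'.support : Set E') = e.hom ⁻¹' closure X') ∧ (∀ p ∈ ℬ', (p.1.support : Set E') ⊆ e.hom ⁻¹' B') := by
  intro Z' σ X' B' h
  induction h with
  | refl =>
    refine ⟨H.support.isClosed, E, inferInstance, inferInstance, inferInstance, 𝟙 E, Iso.refl E, H, H, [], [],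
      IsPureWeightedSeq.nil H, StateIn.init hE hH hlp hred, ?_, fun p hp => by simp at hp⟩
    rw [H.support.isClosed.closure_eq, Iso.refl_hom, preimage_id']
  | @blowup Z' Z'' σ X' B' _ C τ hτ hreg hsub hsing hperm hnc ih =>
    obtain ⟨hX'c, E', hint, hnoeth, hnoethZ, ρ, e, 𝔟', D', ℬ', 𝒟', hseq, S, hsupp, hbd⟩ := ih
    haveI := hint
    haveI := hnoeth
    haveI := hnoethZ
    haveI : IsNoetherian Z'' := isNoetherian_of_isBlowup hτ
    have hclX : closure X' = X' := hX'c.closure_eq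
    refine ⟨isClosed_closure, ?_⟩
    by_cases hC0 : C = ⊤
    · /- EMPTY centre: `τ` is an isomorphism, absorbed into `e` -/
      haveI := isIso_of_isBlowup_top hτ hC0
      have hCs : (C.support : Set Z') = ∅ := by
        rw [hC0, Scheme.IdealSheafData.support_top]; rfl
      refine ⟨E', hint, hnoeth, inferInstance, ρ, e ≪≫ (asIso τ).symm, 𝔟', D', ℬ', 𝒟', hseq, S, ?_, fun p hp => ?_⟩
      · rw [hsupp, hCs, Set.sdiff_empty, hclX, closure_closure, (hX'c.preimage τ.continuous).closure_eq, Iso.trans_hom,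
          Iso.symm_hom, asIso_inv, preimage_comp', preimage_inv_preimage]
      · rw [hCs, Set.union_empty, Iso.trans_hom, Iso.symm_hom, asIso_inv, preimage_comp', preimage_inv_preimage]
        exact hbd p hp
    · /- NON-EMPTY centre: re-sequence along the pieces of `e^* C` on `E'`, all LEGAL -/
      have hCne : (C.support : Set Z').Nonempty := by
        rw [Set.nonempty_iff_ne_empty]
        intro h0
        apply hC0
        rw [← Scheme.IdealSheafData.support_eq_bot_iff]
        exact Closeds.ext h0
      -- the centre read on `E'`, and the blow-up `τ ≫ e⁻¹` along it
      have hC₀reg : Scheme.IsRegular (C.comap e.hom).subscheme := isRegular_subscheme_comap_of_isOpenImmersion e.hom C hreg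
      have hτ₀ : IsBlowup (τ ≫ e.inv) (C.comap e.hom) := by
        have h := hτ.comp_iso e.symm
        rwa [Iso.symm_hom, Iso.symm_inv] at h
      have hC₀s : ((C.comap e.hom).support : Set E') = e.hom ⁻¹' C.support := by
        rw [support_comap]; rfl
      have hCX : (C.support : Set Z') ⊆ closure X' := by
        intro y hy
        have h : y ∈ ((vanishingIdeal (⟨closure X', isClosed_closure⟩ : Closeds Z')).support : Set Z') :=
          support_antitone hsub hy
        rwa [Scheme.IdealSheafData.coe_support_vanishingIdeal] at h
      have hC₀D : ((C.comap e.hom).support : Set E') ⊆ D'.support := by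
        rw [hC₀s, hsupp]; exact Set.preimage_mono hCX
      -- the pieces of the centre
      have hP : IsPiecePartition (C.comap e.hom) (Kollar2007.boundaryPieces (C.comap e.hom)) :=
        isPiecePartition_boundaryPieces_of_isRegular hC₀reg
      have hne : Kollar2007.boundaryPieces (C.comap e.hom) ≠ [] := by
        intro h0
        rw [boundaryPieces_eq_nil_iff] at h0
        obtain ⟨y, hy⟩ := hCne
        have h : e.inv y ∈ ((C.comap e.hom).support : Set E') := by
          rw [hC₀s, Set.mem_preimage, hom_inv_apply]; exact hy
        rw [h0, Scheme.IdealSheafData.support_top] at h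
        exact h
      -- the boundary has snc with the centre (P3 on `Z'`, pushed through `e`)
      have hsncC : HasSNCWith (boundaryOf ℬ') (C.comap e.hom) :=
        hasSNCWith_comap_of_isNormalCrossingWith e S.sncB
          (fun K hK => by obtain ⟨p, hp, rfl⟩ := List.mem_map.mp hK; exact hbd p hp)
          (eq_vanishingIdeal_support_of_isRegular C hreg) hnc
      -- the reduced host ideal read through `e`
      have hDcomap : (vanishingIdeal (⟨closure X', isClosed_closure⟩ : Closeds Z')).comap e.hom = vanishingIdeal D'.support := by
        rw [comap_hom_vanishingIdeal]; congr 1; exact (Closeds.ext hsupp).symm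
      -- the centre data of every piece
      have hΓ : ∀ Z ∈ Kollar2007.boundaryPieces (C.comap e.hom), CentreIn D' ℬ' Z := fun Z hZ =>
        { irred := isIrreducible_of_mem_boundaryPieces hZ
          regZ := isRegular_subscheme_vanishingIdeal_piece hC₀reg hP hZ
          subZ := fun x hx => hC₀D (hP.subset hZ hx)
          sncZ := hsncC.centrePiece hP hZ
          perm := fun z hz => by
            have hzC₀ : z ∈ ((C.comap e.hom).support : Set E') := hP.subset hZ hz
            have hzC : e.hom z ∈ (C.support : Set Z') := by rwa [hC₀s] at hzC₀
            let φ : Z'.presheaf.stalk (e.hom z) ≃+* E'.presheaf.stalk z := (asIso (e.hom.stalkMap z)).commRingCatIsoToRingEquiv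
            have hφ : (φ : Z'.presheaf.stalk (e.hom z) →+* E'.presheaf.stalk z) = (e.hom.stalkMap z).hom := rfl
            have h := isPermissible_map_map_of_ringEquiv φ (hperm (e.hom z) hzC)
            rw [hφ, ← stalkIdeal_comap_eq_map, ← stalkIdeal_comap_eq_map, hDcomap] at h
            rwa [stalkIdeal_centrePiece_eq hC₀reg hP hZ hz] }
      -- LEGALITY: host order `≥ 2` along every piece (the points of the centre are singular points of the host)
      have h2 : ∀ Z ∈ Kollar2007.boundaryPieces (C.comap e.hom), ∀ z ∈ (Z : Set E'), (2 : ℕ∞) ≤ idealOrder D' z :=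
        fun Z hZ z hz => S.forall_two_le_of_sing e hsupp hsub hsing z (hP.subset hZ hz)
      -- the pure pieces loop
      obtain ⟨hint'', hnoeth'', 𝔟'', D'', ℬ'', 𝒟'', hseq', S', hsupp', hbd'⟩ :=
        pure_pieces_loop S hseq hC₀reg hne hP hΓ h2 (B₀ := e.hom ⁻¹' (B' ∪ (C.support : Set Z')))
          (fun p hp => (hbd p hp).trans (Set.preimage_mono Set.subset_union_left))
          (by rw [hC₀s]; exact Set.preimage_mono Set.subset_union_right) hτ₀
      refine ⟨Z'', hint'', hnoeth'', inferInstance, (τ ≫ e.inv) ≫ ρ, Iso.refl Z'', 𝔟'', D'', ℬ'', 𝒟'', hseq', S', ?_,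
        fun p hp => ?_⟩
      · rw [hsupp', hsupp, hC₀s, ← Set.preimage_sdiff, preimage_comp', preimage_inv_preimage_hom, hclX, closure_closure,
          Iso.refl_hom, preimage_id']
      · rw [Iso.refl_hom, preimage_id']
        refine (hbd' p hp).trans ?_
        rw [preimage_comp', preimage_inv_preimage_hom]

/-! ## The END of phase 1: a regular host -/

/-- **The END clause**: if the reduced strict transform `𝓘(cl X₁)` on `Z₁` is a regular closed subscheme and the transport state
on `E₁ ≅ Z₁` has host support `e⁻¹(cl X₁)`, then the host `D'` (being the ideal of its support) is a REGULAR hypersurface.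
[cite: CossartJannsenSaito2020, Thm. 1.4] -/
theorem StateIn.isRegular_host {E₁ Z₁ : Scheme.{u}} [IsLocallyNoetherian E₁] [IsLocallyNoetherian Z₁]
    {𝔟' D' : E₁.IdealSheafData} {ℬ' 𝒟' : List (E₁.IdealSheafData × ℕ)} (S : StateIn 𝔟' D' ℬ' 𝒟') (e : E₁ ≅ Z₁)
    {X₁ : Set Z₁} (hX₁ : Scheme.IsRegular (vanishingIdeal ⟨closure X₁, isClosed_closure⟩).subscheme)
    (hsupp : (D'.support : Set E₁) = e.hom ⁻¹' closure X₁) : Scheme.IsRegular D'.subscheme := by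
  have hD : D' = (vanishingIdeal (⟨closure X₁, isClosed_closure⟩ : Closeds Z₁)).comap e.hom := by
    rw [comap_hom_vanishingIdeal, S.hostRad]
    congr 1
    exact Closeds.ext hsupp
  rw [hD]; exact isRegular_subscheme_comap_of_isOpenImmersion e.hom _ hX₁

/-- [OURS · L1 W5.2 · LSDR₃] **PHASE 1 modulo a TRUNCATED embedded resolution sequence with centres in the singular loci** (an
INLINE hypothesis of the shape of the chain's typing request F-32♯ — NOT a named fact, NOT a premise of the chain): for `E`
integral Noetherian regular and `H ≠ 0` locally principal with reduced zero scheme, if SOME sequence of blowings up of `E` in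
regular centres inside the singular loci of the strict transforms of `Supp H` (permissible, n.c. with the exceptional boundary —
`IsBPermissibleSequence (Supp H) ∅ π X₁ B₁`) ends with a REGULAR reduced strict transform `𝓘(cl X₁)`, then `H` is carried by a
PURE WEIGHT-TWO (legal) sequence to `H' = D' · monomialIdeal ℬ'` with `D'` a REGULAR reduced effective Cartier host and `ℬ'` an
snc boundary with irreducible supports none inside the host (`StateIn`). Input of the PEEL / PHASE 2 hands.
[cite: CossartJannsenSaito2020, Thm. 6.9 (a), Cor. 6.26, Def. 6.23 (2), Lemma 2.31] [cite: Kollar2007, (3.111) Step 1] -/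
theorem legalPhaseOne_of_truncated {E : Scheme.{u}} [IsIntegral E] [IsNoetherian E] (hE : Scheme.IsRegular E)
    (H : E.IdealSheafData) (hH : H ≠ ⊥) (hlp : IsLocallyPrincipal H) (hred : IsReduced H.subscheme)
    (htr : ∃ (Z₁ : Scheme.{u}) (π : Z₁ ⟶ E) (X₁ B₁ : Set Z₁),
      IsBPermissibleSequence (H.support : Set E) (∅ : Set E) π X₁ B₁ ∧
      Scheme.IsRegular (vanishingIdeal ⟨closure X₁, isClosed_closure⟩).subscheme) :
    ∃ (E' : Scheme.{u}) (_ : IsIntegral E') (_ : IsNoetherian E') (ρ : E' ⟶ E) (H' D' : E'.IdealSheafData)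
      (ℬ' 𝒟' : List (E'.IdealSheafData × ℕ)),
      IsPureWeightedSeq 2 ρ H H' ∧ StateIn H' D' ℬ' 𝒟' ∧ Scheme.IsRegular D'.subscheme := by
  obtain ⟨Z₁, π, X₁, B₁, hT, hX₁⟩ := htr
  obtain ⟨-, E', hint, hnoeth, hnoethZ, ρ, e, H', D', ℬ', 𝒟', hseq, S, hsupp, -⟩ := cjs_pure_transport hE H hH hlp hred hT
  haveI := hint
  haveI := hnoeth
  haveI := hnoethZ
  exact ⟨E', hint, hnoeth, ρ, H', D', ℬ', 𝒟', hseq, S, S.isRegular_host e hX₁ hsupp⟩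

end WeightTwoB

end Summit.ResolutionOfSingularities.ResolutionOfSingularities.Theorems

end
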